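import Mathlib.Topology.MetricSpace.Contracting
import HarnessLib

/-!
# The contraction mapping principle with a parameter

Topic `Literature/Analysis/Calculus` (next to `QuadraticFixedPoint.lean`). E. T. Copson, *Metric
Spaces*, Cambridge Tracts in Mathematics 57 (1968), §80 "The fixed point theorem with a
parameter": if `X` is complete and `f(·, t)` is a contraction of ratio `k < 1` uniformly in the
parameter `t`, with `f` continuous, then the fixed point `α(t)` of `f(·, t)` is a continuous
function of `t` (Copson proves it through the uniform convergence of the Picard iterates; the
same statement is the "contraction mapping principle with a parameter" of Loomis–Sternberg,
*Advanced Calculus*). We prove the folklore sharpening in which only the continuity of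
`t ↦ f(x, t)` at the single point `x = α(t₀)` is used, through the a priori estimate
`d(α(t), α(t₀)) ≤ d(f(α(t₀), t), f(α(t₀), t₀)) / (1 - k)` (Mathlib's
`ContractingWith.dist_fixedPoint_le`), in three forms:

* `continuousWithinAt_fixedPoint`, `continuousAt_fixedPoint`, `continuousOn_fixedPoint`,
  `continuous_fixedPoint` — for a family `T p : X → X` of `ContractingWith K` maps of a complete
  space, the map `p ↦ fixedPoint (T p)` is continuous (within a set / at a point / everywhere)
  wherever `p ↦ T p x` is;
* `exists_fixedPoint_continuousOn_of_mapsTo` — Copson's setting of a closed (complete)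
  forward-invariant set `B ⊆ X` on which each `T p`, `p ∈ S`, is `K`-Lipschitz with `K < 1`:
  there is a fixed-point map `α : P → X`, `α(S) ⊆ B`, `T p (α p) = α p`, unique in `B`, and
  continuous on `S`.

This is the version of the contraction mapping principle invoked by G. Slade, *Critical exponents
for long-range `O(n)` models below the upper critical dimension*, Commun. Math. Phys. 358 (2018),
in the proof of Corollary 7.2.4 (continuity of the critical initial condition `μ₀(m̃², m²)` of
the renormalisation-group flow: the map `T` of Theorem 7.2.2 is a uniform contraction of the
closed unit ball `B₁(X)`, continuous in the parameters by Lemma 7.2.1).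

## References

* E. T. Copson, *Metric Spaces*, Cambridge University Press (1968), §72 and §80.
* G. Slade, Commun. Math. Phys. 358 (2018) 343–436, Lemma 7.2.1, Theorem 7.2.2, Corollary 7.2.4.
-/

open Set Metric Function Filter
open scoped Topology NNReal

namespace Literature.Analysis.Calculus

variable {P X : Type*} [TopologicalSpace P] [MetricSpace X]

section Global

variable [CompleteSpace X] [Nonempty X] {K : ℝ≥0} {T : P → X → X}

omit [TopologicalSpace P] in
/-- **A priori comparison of the fixed points of two contractions of the same ratio**: for
`ContractingWith K` maps `T p`, `T q`,
`d(x_q, x_p) ≤ d(T q x_p, T p x_p) / (1 - K)` where `x_p`, `x_q` are the fixed points — the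
estimate behind the continuous dependence of the fixed point on a parameter.
[cite: Copson1968, §80] -/
theorem dist_fixedPoint_fixedPoint_le_div (hT : ∀ p, ContractingWith K (T p)) (p q : P) :
    dist (ContractingWith.fixedPoint (T q) (hT q)) (ContractingWith.fixedPoint (T p) (hT p)) ≤
      dist (T q (ContractingWith.fixedPoint (T p) (hT p)))
          (T p (ContractingWith.fixedPoint (T p) (hT p))) / (1 - K) := by
  set x := ContractingWith.fixedPoint (T p) (hT p) with hx
  have hfix : T p x = x := (hT p).fixedPoint_isFixedPt
  calc dist (ContractingWith.fixedPoint (T q) (hT q)) x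
        = dist x (ContractingWith.fixedPoint (T q) (hT q)) := dist_comm _ _
    _ ≤ dist x (T q x) / (1 - K) := (hT q).dist_fixedPoint_le x
    _ = dist (T q x) (T p x) / (1 - K) := by rw [hfix, dist_comm]

/-- **The contraction mapping principle with a parameter, local form.** Let `T p : X → X`
(`p ∈ P`, `X` complete) be contractions with a common ratio `K < 1`, and let `x₀` be the fixed
point of `T p₀`. If `p ↦ T p x₀` is continuous at `p₀` within `S`, then so is the fixed-point map
`p ↦ fixedPoint (T p)`. [cite: Copson1968, §80] -/
theorem continuousWithinAt_fixedPoint (hT : ∀ p, ContractingWith K (T p)) {S : Set P} {p₀ : P}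
    (hc : ContinuousWithinAt (fun p => T p (ContractingWith.fixedPoint (T p₀) (hT p₀))) S p₀) :
    ContinuousWithinAt (fun p => ContractingWith.fixedPoint (T p) (hT p)) S p₀ := by
  set x₀ := ContractingWith.fixedPoint (T p₀) (hT p₀) with hx₀
  have hK : (0 : ℝ) < 1 - K := (hT p₀).one_sub_K_pos
  have hfix : T p₀ x₀ = x₀ := (hT p₀).fixedPoint_isFixedPt
  rw [ContinuousWithinAt, Metric.tendsto_nhds] at hc ⊢
  intro ε hε
  filter_upwards [hc (ε * (1 - K)) (by positivity)] with p hp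
  rw [hfix] at hp
  calc dist (ContractingWith.fixedPoint (T p) (hT p)) x₀
        ≤ dist (T p x₀) (T p₀ x₀) / (1 - K) := dist_fixedPoint_fixedPoint_le_div hT p₀ p
    _ = dist (T p x₀) x₀ / (1 - K) := by rw [hfix]
    _ < ε * (1 - K) / (1 - K) := by gcongr
    _ = ε := by field_simp

/-- The contraction mapping principle with a parameter, at a point: if `p ↦ T p x₀` is
continuous at `p₀`, `x₀` the fixed point of `T p₀`, then `p ↦ fixedPoint (T p)` is continuous
at `p₀`. [cite: Copson1968, §80] -/
theorem continuousAt_fixedPoint (hT : ∀ p, ContractingWith K (T p)) {p₀ : P}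
    (hc : ContinuousAt (fun p => T p (ContractingWith.fixedPoint (T p₀) (hT p₀))) p₀) :
    ContinuousAt (fun p => ContractingWith.fixedPoint (T p) (hT p)) p₀ := by
  rw [← continuousWithinAt_univ] at hc ⊢
  exact continuousWithinAt_fixedPoint hT hc

/-- The contraction mapping principle with a parameter, on a set: if `p ↦ T p x` is continuous
on `S` for every `x`, then `p ↦ fixedPoint (T p)` is continuous on `S`.
[cite: Copson1968, §80] -/
theorem continuousOn_fixedPoint (hT : ∀ p, ContractingWith K (T p)) {S : Set P}
    (hc : ∀ x, ContinuousOn (fun p => T p x) S) :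
    ContinuousOn (fun p => ContractingWith.fixedPoint (T p) (hT p)) S :=
  fun p₀ hp₀ => continuousWithinAt_fixedPoint hT (hc _ p₀ hp₀)

/-- **The contraction mapping principle with a parameter** (Copson, *Metric Spaces*, §80, with
continuity of `f` in the parameter for each fixed point of the space in place of joint
continuity): for a family of contractions `T p` of a complete metric space with a common ratio
`K < 1`, depending continuously on `p` pointwise, the fixed point depends continuously on `p`.
[cite: Copson1968, §80] -/
theorem continuous_fixedPoint (hT : ∀ p, ContractingWith K (T p))
    (hc : ∀ x, Continuous fun p => T p x) :
    Continuous fun p => ContractingWith.fixedPoint (T p) (hT p) :=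
  continuous_iff_continuousAt.2 fun _ => continuousAt_fixedPoint hT (hc _).continuousAt

end Global

/-- **The contraction mapping principle with a parameter on an invariant complete set**
(Copson's setting, §72 and §80; the form used by Slade for the closed unit ball `B₁(X)` of a
Banach space in Corollary 7.2.4). Let `B ⊆ X` be complete and nonempty, `S ⊆ P` a set of
parameters, and for `p ∈ S` let `T p` map `B` into itself and be `K`-Lipschitz on `B` with
`K < 1`; suppose `p ↦ T p x` is continuous on `S` for each `x ∈ B`. Then there is `α : P → X`
with, for every `p ∈ S`: `α p ∈ B`, `T p (α p) = α p`, `α p` is the only fixed point of `T p`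
in `B`; and `α` is continuous on `S`. [cite: Copson1968, §80]
[cite: Slade2017, Corollary 7.2.4 (proof)] -/
theorem exists_fixedPoint_continuousOn_of_mapsTo {S : Set P} {B : Set X} (hBc : IsComplete B)
    (hBne : B.Nonempty) {K : ℝ≥0} (hK : K < 1) {T : P → X → X}
    (hmaps : ∀ p ∈ S, MapsTo (T p) B B) (hlip : ∀ p ∈ S, LipschitzOnWith K (T p) B)
    (hc : ∀ x ∈ B, ContinuousOn (fun p => T p x) S) :
    ∃ α : P → X, ContinuousOn α S ∧ (∀ p ∈ S, α p ∈ B ∧ T p (α p) = α p) ∧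
      ∀ p ∈ S, ∀ y ∈ B, T p y = y → y = α p := by
  classical
  haveI : CompleteSpace B := hBc.completeSpace_coe
  haveI : Nonempty B := hBne.to_subtype
  -- the restricted maps `T' p : B → B` (arbitrary off `S`)
  let T' : P → B → B := fun p =>
    if hp : p ∈ S then (hmaps p hp).restrict (T p) B B else fun _ => Classical.arbitrary B
  have hT'S : ∀ p (hp : p ∈ S), T' p = (hmaps p hp).restrict (T p) B B := fun p hp => by
    simp only [T', dif_pos hp]
  have hT'val : ∀ p ∈ S, ∀ x : B, ((T' p x : B) : X) = T p x := fun p hp x => by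
    rw [hT'S p hp]; rfl
  have hT' : ∀ p, ContractingWith K (T' p) := by
    intro p
    by_cases hp : p ∈ S
    · rw [hT'S p hp]; exact ⟨hK, (hlip p hp).mapsToRestrict (hmaps p hp)⟩
    · simp only [T', dif_neg hp]
      exact ⟨hK, (LipschitzWith.const (Classical.arbitrary B)).weaken zero_le⟩
  let α : P → X := fun p => ((ContractingWith.fixedPoint (T' p) (hT' p) : B) : X)
  have hαmem : ∀ p, α p ∈ B := fun p => (ContractingWith.fixedPoint (T' p) (hT' p)).2
  have hαfix : ∀ p ∈ S, T p (α p) = α p := by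
    intro p hp
    have h := (hT' p).fixedPoint_isFixedPt
    rw [IsFixedPt] at h
    have := congrArg (fun z : B => (z : X)) h
    simpa only [hT'val p hp] using this
  refine ⟨α, ?_, fun p hp => ⟨hαmem p, hαfix p hp⟩, ?_⟩
  · -- continuity on `S`, through the subtype-valued fixed-point map
    have hcont : ContinuousOn (fun p => ContractingWith.fixedPoint (T' p) (hT' p)) S := by
      intro p₀ hp₀
      apply continuousWithinAt_fixedPoint hT'
      set x₀ := ContractingWith.fixedPoint (T' p₀) (hT' p₀) with hx₀
      have hx : ContinuousWithinAt (fun p => T p (x₀ : X)) S p₀ := hc _ x₀.2 p₀ hp₀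
      rw [ContinuousWithinAt, Metric.tendsto_nhds] at hx ⊢
      intro ε hε
      filter_upwards [hx ε hε, self_mem_nhdsWithin] with p hp hpS
      rw [Subtype.dist_eq, hT'val p hpS, hT'val p₀ hp₀]
      exact hp
    exact continuous_subtype_val.comp_continuousOn hcont
  · intro p hp y hy hfix
    have h1 : IsFixedPt (T' p) ⟨y, hy⟩ := by
      rw [IsFixedPt]; apply Subtype.ext; rw [hT'val p hp]; exact hfix
    have := (hT' p).fixedPoint_unique h1
    exact congrArg (fun z : B => (z : X)) this

/-- The same on a closed subset of a complete space (e.g. a closed ball of a Banach space, as in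
Slade's Corollary 7.2.4). [cite: Copson1968, §80] [cite: Slade2017, Corollary 7.2.4 (proof)] -/
theorem exists_fixedPoint_continuousOn_of_isClosed [CompleteSpace X] {S : Set P} {B : Set X}
    (hB : IsClosed B) (hBne : B.Nonempty) {K : ℝ≥0} (hK : K < 1) {T : P → X → X}
    (hmaps : ∀ p ∈ S, MapsTo (T p) B B) (hlip : ∀ p ∈ S, LipschitzOnWith K (T p) B)
    (hc : ∀ x ∈ B, ContinuousOn (fun p => T p x) S) :
    ∃ α : P → X, ContinuousOn α S ∧ (∀ p ∈ S, α p ∈ B ∧ T p (α p) = α p) ∧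
      ∀ p ∈ S, ∀ y ∈ B, T p y = y → y = α p :=
  exists_fixedPoint_continuousOn_of_mapsTo hB.isComplete hBne hK hmaps hlip hc

end Literature.Analysis.Calculus
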